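import Summits.BirchSwinnertonDyer.Rank1Residual.AdditivePotMult.QuadraticBaseChangeRegulatorRankOne
import Summits.BirchSwinnertonDyer.Rank1Residual.AdditivePotMult.RegulatorIndexSquare
import HarnessLib

/-!
# The regulator under quadratic base change in ANY rank: the Gram-determinant comparison
# `n² · Reg(E_K) = 2^r · Reg(E) · Reg(E^{(d_K)})`, `n ∣ 2^r`, `r = rank E(ℚ) + rank E^{(d_K)}(ℚ)`
# (row T-MIL-R2, FILE J-1b; seat n1011-p01 GEN 9)

HONEST FRAMING (cell `b2b-bsdres`, run/shared/lean/b2b/bsd-rank1-residual/, verbatim in every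
file): the goal of the cell is to DELETE the COMBINATION-SHAPED residual classes of the
Birch–Swinnerton-Dyer formula for ALL analytic-rank `≤ 1` elliptic curves over `ℚ` — "full BSD
formula for every rank `≤ 1` curve in class `C`" assembled STRICTLY from published theorems — so
that the rank-`≤ 1` remainder becomes exactly the CONSTRUCTION-SHAPED classes, which are TYPED
(missing-input `Prop`s), NOT attempted. This is not "finishing BSD". Sub-classes X3♯(M) / X4(M)
(additive, potentially multiplicative prime; base-change-and-descend): a RESEARCH ROUTE; they stay
CONSTRUCTION-SHAPED; nothing is booked by this file; no mark / label moved. THEOREMS ONLY: no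
definition, no named fact, no `sorry`.

## What (row T-MIL-R2, `cells/n1011/skel/T-MIL-R2.md` §1–§2, FILE J-1b)

FILE E-1 (`QuadraticBaseChangeRegulatorRankOne`) compared the regulators of `W/ℚ`, its twist
`W^{(d_K)}` and the base change `W_K` in TOTAL RANK `≤ 1` only, through the rank-one height–index
relations; its HONEST LIMITS named the gap "total rank `≥ 2` needs the Gram-determinant form of
the comparison". This file proves the Gram-determinant form in EVERY rank:

* the TOOL is FILE J-1a (`RegulatorIndexSquare`): Gross's `det⟨Qᵢ,Qⱼ⟩ = [E(K)/tors : ⟨Q̄ᵢ⟩]² ·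
  Reg(E/K)` (`regulatorOf_eq_index_sq_mul_regulator`), independence from `det ≠ 0` (tree
  `soloInformedJoint_linearIndependent_of_regulatorOf_ne_zero`), `index_dvd_pow_mordellWeilRank_of_smul_mem`.
* §2 quadratic base change `K = ℚ(θ)`, `θ² = c`: for Mordell–Weil bases `P` of `W(ℚ)` and `Pd`
  of `W^{(c)}(ℚ)`, the family `Q = (ι P, ψ Pd)` in `W(K)` (`ι` the inclusion, `ψ = Φ_K ∘ ι` the
  twist substitution of seat additive-p1, `TwistPointsOver`) has BLOCK-DIAGONAL Gram matrix
  `diag(2⟨Pᵢ,Pⱼ⟩, 2⟨Pdᵢ,Pdⱼ⟩)` (heights double under base change; `ι P ⟂ ψ Pd` because the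
  conjugation `σ` fixes `ι P`, negates `ψ Pd` and preserves the pairing), so
  `det⟨Qᵢ,Qⱼ⟩ = 2^{r₁+r₂} Reg(W) Reg(W^{(c)})`; and `2·W(K) ⊆ ι W(ℚ) + ψ W^{(c)}(ℚ) + tors`
  (`2R = (R + σR) + (R − σR)`), so the index `n` divides `2^{r₁+r₂}`:
  `exists_dvd_sq_mul_regulator_baseChange_eq_of_sq`.
* §3 arbitrary models `Wd ≅ W^{(d_K)}`, `W' ≅ W_K` (as E-1 §2):
  **`exists_dvd_sq_mul_regulator_baseChange_quadratic` — `∃ n ∣ 2^r, n² · Reg(W') = 2^r · Reg(W) ·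
  Reg(Wd)`, `r = rank W(ℚ) + rank Wd(ℚ)`, ANY ranks, EITHER signature** (total rank `≤ 1`: E-1;
  ranks `(1,1)`: `n ∈ {1,2,4}`, `n² Reg(W') = 4 Reg(W) Reg(Wd)` — `…_of_rank_one_one`).

HONEST LIMITS: `n` is not determined (only `n ∣ 2^r`); `K` quadratic; TOOL theorems; closes no
class; moves no mark; no named fact. The `p`-adic consequence (units at odd `p`) is FILE J-2's.

References: B. H. Gross, PCMI 18 (2011), Lecture 1 §4, Def. 1.6 [Gross2011]; J. H. Silverman,
*AEC* 2nd ed., VIII.9, Exercise 10.16 [SilvermanAEC2009]; B. Gross, D. Zagier, Invent. Math. 84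
(1986) V.§2 (p. 311) [GrossZagier1986]; Jetchev–Skinner–Wan, Camb. J. Math. 5 (2017) §7.4.1.
-/

noncomputable section

open scoped Classical

/-! ## §2 Quadratic base change `K = ℚ(θ)`, `θ² = c`: the block-diagonal Gram matrix -/

namespace Summit.BirchSwinnertonDyer.Rank1Residual.AdditivePotMult

open WeierstrassCurve Affine.Point Literature.NumberTheory.EllipticCurves
  Literature.NumberTheory.EllipticCurves.KrizLi2019 Literature.NumberTheory.QuadraticFields

section Raw

-- Tree lemmas over a general field `F` carry the classical `DecidableEq F`; at `F = ℚ` each proof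
-- applying them starts with a proof-local classical `DecidableEq ℚ` (`letI`), else `instDecidableEqRat`.
variable (W : WeierstrassCurve ℚ) [W.IsElliptic] (K : Type) [Field K] [NumberField K]
  (h2 : Module.finrank ℚ K = 2) {θ : K} {c : ℚ} (hθ : θ ∉ Set.range (algebraMap ℚ K))
  (hc : θ ^ 2 = algebraMap ℚ K c)

include h2 in
/-- **The pairing doubles under quadratic base change**: `⟨ι x, ι y⟩_K = 2 · ⟨x, y⟩_ℚ` for the
inclusion `ι : W(ℚ) → W(K)`, `[K:ℚ] = 2` (tree `heightPairing_baseChange`; the heights over `K` are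
the `K`-normalised ones, `ĥ_K = [K:ℚ] ĥ_ℚ` on `ℚ`-points). [cite: SilvermanAEC2009, Prop. VIII.5.4(b)] -/
theorem heightPairing_incl_incl (x y : W.toAffine.Point) :
    heightPairing (QuadraticDescent.incl K W x) (QuadraticDescent.incl K W y) =
      2 * heightPairing x y := by
  letI : DecidableEq ℚ := fun a b => Classical.propDecidable (a = b)
  have h := heightPairing_baseChange (R := ℚ) (K := ℚ) (L := K) (W := W) x y
  rw [h2] at h
  exact_mod_cast h

omit [W.IsElliptic] in
include hθ hc in
/-- **The twist substitution preserves the pairing**: `⟨Φ_K a, Φ_K b⟩ = ⟨a, b⟩` for additive-p1's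
`Φ_K : W^{(c)}(K) ≃+ W(K)` (`twistPointEquivOver`; it is additive and preserves canonical heights,
`canonicalHeight_twistPointEquivOver`). [cite: SilvermanAEC2009, Prop. VIII.9.1] -/
theorem heightPairing_twistPointEquivOver (a b : ((W.quadraticTwist c).baseChange K).toAffine.Point) :
    heightPairing (twistPointEquivOver W hθ hc a) (twistPointEquivOver W hθ hc b) = heightPairing a b := by
  unfold heightPairing
  rw [← map_add, canonicalHeight_twistPointEquivOver, canonicalHeight_twistPointEquivOver,
    canonicalHeight_twistPointEquivOver]

omit [W.IsElliptic] in
include h2 hθ hc in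
/-- **`⟨ψ x, ψ y⟩_K = 2 · ⟨x, y⟩_ℚ` for the twist map `ψ = Φ_K ∘ ι : W^{(c)}(ℚ) → W(K)`** (the
pairing on the right is that of the twist `W^{(c)}/ℚ`): `Φ_K` preserves the pairing and `ι`
doubles it. [cite: SilvermanAEC2009, Prop. VIII.5.4(b) and Prop. VIII.9.1] -/
theorem heightPairing_twist_twist [(W.quadraticTwist c).IsElliptic]
    (x y : (W.quadraticTwist c).toAffine.Point) :
    heightPairing (twistPointEquivOver W hθ hc (QuadraticDescent.incl K (W.quadraticTwist c) x))
        (twistPointEquivOver W hθ hc (QuadraticDescent.incl K (W.quadraticTwist c) y)) =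
      2 * heightPairing x y := by
  letI : DecidableEq ℚ := fun a b => Classical.propDecidable (a = b)
  rw [heightPairing_twistPointEquivOver W K hθ hc]
  have h := heightPairing_baseChange (R := ℚ) (K := ℚ) (L := K) (W := W.quadraticTwist c) x y
  rw [h2] at h
  exact_mod_cast h

include h2 in
/-- **`ι W(ℚ) ⟂ ψ W^{(c)}(ℚ)` in `W(K)`: `⟨ι x, ψ y⟩_K = 0`.** The conjugation `σ` of `K/ℚ` fixes
`ι x` (`Affine.Point.map_baseChange`), NEGATES `ψ y` (anti-naturality `σ Φ_K = −Φ_K σ` of the twist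
substitution, additive-p1's `map_twistPointEquivOver_of_neg`, and `σ ι = ι` on the twist) and
preserves the Néron–Tate pairing (`heightPairing_map_self`, Galois invariance of heights); so
`⟨ι x, ψ y⟩ = ⟨ι x, −ψ y⟩ = −⟨ι x, ψ y⟩`. [cite: SilvermanAEC2009, Exercise 10.16]
[cite: BombieriGubler2001, Prop. 1.5.17] -/
theorem heightPairing_incl_twist_eq_zero [(W.quadraticTwist c).IsElliptic] (x : W.toAffine.Point)
    (y : (W.quadraticTwist c).toAffine.Point) :
    heightPairing (QuadraticDescent.incl K W x)
      (twistPointEquivOver W hθ hc (QuadraticDescent.incl K (W.quadraticTwist c) y)) = 0 := by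
  letI : DecidableEq ℚ := fun a b => Classical.propDecidable (a = b)
  haveI : (W.baseChange K).IsElliptic := isElliptic_baseChange' W K
  set σ : (W.baseChange K).toAffine.Point →+ (W.baseChange K).toAffine.Point :=
    Affine.Point.map (W' := W) (Quadratic.conj h2 hθ hc) with hσ_def
  have hσι : σ (QuadraticDescent.incl K W x) = QuadraticDescent.incl K W x :=
    Affine.Point.map_baseChange (W' := W) (Quadratic.conj h2 hθ hc) x
  have hσdι : Affine.Point.map (W' := W.quadraticTwist c) (Quadratic.conj h2 hθ hc)
      (QuadraticDescent.incl K (W.quadraticTwist c) y) = QuadraticDescent.incl K (W.quadraticTwist c) y :=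
    Affine.Point.map_baseChange (W' := W.quadraticTwist c) (Quadratic.conj h2 hθ hc) y
  have hσψ : σ (twistPointEquivOver W hθ hc (QuadraticDescent.incl K (W.quadraticTwist c) y)) =
      -twistPointEquivOver W hθ hc (QuadraticDescent.incl K (W.quadraticTwist c) y) := by
    rw [hσ_def, map_twistPointEquivOver_of_neg W hθ hc hθ hc (Quadratic.conj h2 hθ hc)
      (Quadratic.conj_gen h2 hθ hc), hσdι]
  have h := heightPairing_map_self (R := ℚ) (S := ℚ) (W := W) (Quadratic.conj h2 hθ hc)
    (QuadraticDescent.incl K W x)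
    (twistPointEquivOver W hθ hc (QuadraticDescent.incl K (W.quadraticTwist c) y))
  rw [← hσ_def, hσι, hσψ, ← neg_one_zsmul, heightPairing_zsmul_right] at h
  push_cast at h
  linarith

include h2 in
/-- **The Gram matrix of `(ι P, ψ Pd)` is block diagonal `diag(2⟨Pᵢ,Pⱼ⟩, 2⟨Pdᵢ,Pdⱼ⟩)`** for any
families `P : ι₁ → W(ℚ)`, `Pd : ι₂ → W^{(c)}(ℚ)` (`heightPairing_incl_incl`,
`heightPairing_twist_twist`, `heightPairing_incl_twist_eq_zero` and symmetry).
[cite: SilvermanAEC2009, Exercise 10.16] -/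
theorem heightPairingMatrix_incl_twist [(W.quadraticTwist c).IsElliptic] {ι₁ ι₂ : Type*}
    (P : ι₁ → W.toAffine.Point) (Pd : ι₂ → (W.quadraticTwist c).toAffine.Point) :
    heightPairingMatrix (Sum.elim (fun i => QuadraticDescent.incl K W (P i))
        (fun j => twistPointEquivOver W hθ hc (QuadraticDescent.incl K (W.quadraticTwist c) (Pd j)))) =
      Matrix.fromBlocks ((2 : ℝ) • heightPairingMatrix P) 0 0 ((2 : ℝ) • heightPairingMatrix Pd) := by
  ext (i | i) (j | j)
  · rw [heightPairingMatrix_apply, Sum.elim_inl, Sum.elim_inl, Matrix.fromBlocks_apply₁₁,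
      Matrix.smul_apply, heightPairingMatrix_apply, smul_eq_mul, heightPairing_incl_incl W K h2]
  · rw [heightPairingMatrix_apply, Sum.elim_inl, Sum.elim_inr, Matrix.fromBlocks_apply₁₂,
      Matrix.zero_apply, heightPairing_incl_twist_eq_zero W K h2 hθ hc]
  · rw [heightPairingMatrix_apply, Sum.elim_inr, Sum.elim_inl, Matrix.fromBlocks_apply₂₁,
      Matrix.zero_apply, heightPairing_symm, heightPairing_incl_twist_eq_zero W K h2 hθ hc]
  · rw [heightPairingMatrix_apply, Sum.elim_inr, Sum.elim_inr, Matrix.fromBlocks_apply₂₂,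
      Matrix.smul_apply, heightPairingMatrix_apply, smul_eq_mul, heightPairing_twist_twist W K h2 hθ hc]

include h2 in
/-- **`det⟨Qᵢ,Qⱼ⟩ = 2^{#ι₁} det⟨Pᵢ,Pⱼ⟩ · 2^{#ι₂} det⟨Pdᵢ,Pdⱼ⟩` for `Q = (ι P, ψ Pd)`** (block
determinant of `heightPairingMatrix_incl_twist`; Mathlib `Matrix.det_fromBlocks_zero₂₁`,
`Matrix.det_smul`). [cite: SilvermanAEC2009, Exercise 10.16] -/
theorem regulatorOf_incl_twist [(W.quadraticTwist c).IsElliptic] {ι₁ ι₂ : Type*} [Fintype ι₁]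
    [DecidableEq ι₁] [Fintype ι₂] [DecidableEq ι₂]
    (P : ι₁ → W.toAffine.Point) (Pd : ι₂ → (W.quadraticTwist c).toAffine.Point) :
    regulatorOf (Sum.elim (fun i => QuadraticDescent.incl K W (P i))
        (fun j => twistPointEquivOver W hθ hc (QuadraticDescent.incl K (W.quadraticTwist c) (Pd j)))) =
      (2 ^ Fintype.card ι₁ * regulatorOf P) * (2 ^ Fintype.card ι₂ * regulatorOf Pd) := by
  rw [regulatorOf, heightPairingMatrix_incl_twist W K h2 hθ hc, regulatorOf, regulatorOf,
    ← Matrix.det_smul, ← Matrix.det_smul]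
  -- `det` carries a `DecidableEq` instance on the index type; `convert` identifies the instance
  -- on `ι₁ ⊕ ι₂` found here with the one assembled by `Matrix.det_fromBlocks_zero₂₁`
  convert Matrix.det_fromBlocks_zero₂₁ ((2 : ℝ) • heightPairingMatrix P) 0
    ((2 : ℝ) • heightPairingMatrix Pd) using 2

include h2 hθ hc in
/-- **THE REGULATOR UNDER QUADRATIC BASE CHANGE, ANY RANK (raw form).** For `W/ℚ` elliptic and
`K = ℚ(θ)`, `θ² = c`: `∃ n ∣ 2^r, n² · Reg(W_K) = 2^r · Reg(W) · Reg(W^{(c)})` with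
`r = rank W(ℚ) + rank W^{(c)}(ℚ)` (`= rank W(K)`, `mordellWeilRank_baseChange_eq_add_of_sq`). Here
`n = [W(K)/tors : ⟨ι P, ψ Pd⟩]` for Mordell–Weil bases `P`, `Pd` of `W(ℚ)`, `W^{(c)}(ℚ)`: the family
`Q = (ι P, ψ Pd)` has `det⟨Qᵢ,Qⱼ⟩ = 2^r Reg(W) Reg(W^{(c)}) > 0` (`regulatorOf_incl_twist`), hence is
independent modulo torsion (tree `soloInformedJoint_linearIndependent_of_regulatorOf_ne_zero`) of full rank, so
`det⟨Qᵢ,Qⱼ⟩ = n² Reg(W_K)` (`regulatorOf_eq_index_sq_mul_regulator`); and `n ∣ 2^r` because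
`2R = (R + σR) + (R − σR) ∈ ι W(ℚ) + ψ W^{(c)}(ℚ)` for every `R ∈ W(K)` (`σ`-fixed points are
`ℚ`-rational, `mem_range_incl_of_map_conj_eq`; `σ`-anti-fixed points come from the twist, via the
anti-naturality of `Φ_K`), i.e. `2 · (W(K)/tors) ⊆ ⟨Q̄⟩` (`index_dvd_pow_mordellWeilRank_of_smul_mem`).
Gross–Zagier 1986 V.§2 (p. 311) / Silverman AEC Exercise 10.16 (`E(K) ⊗ ℤ[½] = E(ℚ) ⊕ E^{(d)}(ℚ)
⊗ ℤ[½]`) made exact on regulators. [cite: GrossZagier1986, V.§2 (p. 311)]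
[cite: SilvermanAEC2009, Exercise 10.16] [cite: Gross2011, Lecture 1 §4, Def. 1.6] -/
theorem exists_dvd_sq_mul_regulator_baseChange_eq_of_sq [(W.quadraticTwist c).IsElliptic] :
    ∃ n : ℕ, n ∣ 2 ^ (W.mordellWeilRank + (W.quadraticTwist c).mordellWeilRank) ∧
      (n : ℝ) ^ 2 * (W.baseChange K).regulator =
        2 ^ (W.mordellWeilRank + (W.quadraticTwist c).mordellWeilRank) * W.regulator *
          (W.quadraticTwist c).regulator := by
  letI : DecidableEq ℚ := fun a b => Classical.propDecidable (a = b)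
  haveI : (W.baseChange K).IsElliptic := isElliptic_baseChange' W K
  haveI : ((W.quadraticTwist c).baseChange K).IsElliptic := isElliptic_baseChange' _ K
  haveI : NeZero (2 : ℚ) := ⟨two_ne_zero⟩
  -- Mordell–Weil bases downstairs
  obtain ⟨P, hP⟩ := exists_isMordellWeilBasis_holds W
  obtain ⟨Pd, hPd⟩ := exists_isMordellWeilBasis_holds (W.quadraticTwist c)
  -- notation
  set ι : W.toAffine.Point →+ (W.baseChange K).toAffine.Point := QuadraticDescent.incl K W with hι_def
  set ιd := QuadraticDescent.incl K (W.quadraticTwist c) with hιd_def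
  set Φ := twistPointEquivOver W (A := K) hθ hc with hΦ_def
  set T := AddCommGroup.torsion (W.baseChange K).toAffine.Point with hT_def
  set Q : Fin W.mordellWeilRank ⊕ Fin (W.quadraticTwist c).mordellWeilRank →
      (W.baseChange K).toAffine.Point :=
    Sum.elim (fun i => ι (P i)) (fun j => Φ (ιd (Pd j))) with hQ_def
  -- the Gram determinant of `Q`
  have hreg : regulatorOf Q = (2 ^ W.mordellWeilRank * W.regulator) *
      (2 ^ (W.quadraticTwist c).mordellWeilRank * (W.quadraticTwist c).regulator) := by
    rw [hQ_def, regulatorOf_incl_twist W K h2 hθ hc, Fintype.card_fin, Fintype.card_fin,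
      hP.regulatorOf_eq_regulator, hPd.regulatorOf_eq_regulator]
  have hreg0 : regulatorOf Q ≠ 0 := by
    rw [hreg]
    have h1 := regulator_pos' W
    have h2' := regulator_pos' (W.quadraticTwist c)
    positivity
  have hli := Summit.BirchSwinnertonDyer.BirchSwinnertonDyer.Theorems.soloInformedJoint_linearIndependent_of_regulatorOf_ne_zero hreg0
  have hrank : (W.baseChange K).mordellWeilRank =
      W.mordellWeilRank + (W.quadraticTwist c).mordellWeilRank :=
    mordellWeilRank_baseChange_eq_add_of_sq W K h2 hθ hc
  have hcard : Fintype.card (Fin W.mordellWeilRank ⊕ Fin (W.quadraticTwist c).mordellWeilRank) =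
      (W.baseChange K).mordellWeilRank := by
    rw [Fintype.card_sum, Fintype.card_fin, Fintype.card_fin, hrank]
  have key := regulatorOf_eq_index_sq_mul_regulator hli hcard
  set L := AddSubgroup.closure (Set.range (QuotientAddGroup.mk ∘ Q :
    _ → mordellWeilModTorsion (W.baseChange K))) with hL_def
  -- the conjugation and its action
  set σ : (W.baseChange K).toAffine.Point →+ (W.baseChange K).toAffine.Point :=
    Affine.Point.map (W' := W) (Quadratic.conj h2 hθ hc) with hσ_def
  set σd : ((W.quadraticTwist c).baseChange K).toAffine.Point →+
      ((W.quadraticTwist c).baseChange K).toAffine.Point :=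
    Affine.Point.map (W' := W.quadraticTwist c) (Quadratic.conj h2 hθ hc) with hσd_def
  have hσσ : ∀ x, σ (σ x) = x := fun x =>
    QuadraticDescent.conjMap_conjMap W (Quadratic.conj_conj h2 hθ hc) x
  have hσdι : ∀ y, σd (ιd y) = ιd y := fun y =>
    Affine.Point.map_baseChange (W' := W.quadraticTwist c) (Quadratic.conj h2 hθ hc) y
  have hanti : ∀ x, σ (Φ x) = -Φ (σd x) := fun x =>
    map_twistPointEquivOver_of_neg W hθ hc hθ hc (Quadratic.conj h2 hθ hc)
      (Quadratic.conj_gen h2 hθ hc) x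
  -- `σ`-anti-fixed points of `W(K)` come from the twist
  have hrange : ∀ R : (W.baseChange K).toAffine.Point, σ R = -R → ∃ y, Φ (ιd y) = R := by
    intro R hR
    set x := Φ.symm R with hx
    have hΦx : Φ x = R := Φ.apply_symm_apply R
    have hfix : σd x = x := by
      apply Φ.injective
      have := hanti x
      rw [hΦx, hR] at this
      have h' : Φ (σd x) = R := neg_injective this.symm
      rw [h', hΦx]
    obtain ⟨y, hy⟩ := AddMonoidHom.mem_range.mp
      (mem_range_incl_of_map_conj_eq (W.quadraticTwist c) K h2 hθ hc x hfix)
    exact ⟨y, by rw [show ιd y = x from hy, hΦx]⟩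
  -- the classes of `ι W(ℚ)` and of `ψ W^{(c)}(ℚ)` lie in `L`
  have hTι : AddCommGroup.torsion W.toAffine.Point ≤ T.comap ι := fun t ht => by
    rw [AddSubgroup.mem_comap, hT_def, AddCommGroup.mem_torsion]
    exact ι.isOfFinAddOrder ((AddCommGroup.mem_torsion _).mp ht)
  have hTψ : AddCommGroup.torsion (W.quadraticTwist c).toAffine.Point ≤
      T.comap (Φ.toAddMonoidHom.comp ιd) := fun t ht => by
    rw [AddSubgroup.mem_comap, hT_def, AddCommGroup.mem_torsion]
    exact (Φ.toAddMonoidHom.comp ιd).isOfFinAddOrder ((AddCommGroup.mem_torsion _).mp ht)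
  have hιL : ∀ y : W.toAffine.Point, (QuotientAddGroup.mk (ι y) : mordellWeilModTorsion (W.baseChange K)) ∈ L := by
    intro y
    have hy : (QuotientAddGroup.mk y : mordellWeilModTorsion W) ∈
        Submodule.span ℤ (Set.range (QuotientAddGroup.mk ∘ P : _ → mordellWeilModTorsion W)) := by
      rw [hP.2]; exact Submodule.mem_top
    obtain ⟨cf, hcf⟩ := Submodule.mem_span_range_iff_exists_fun ℤ |>.mp hy
    have hmap : (QuotientAddGroup.mk (ι y) : mordellWeilModTorsion (W.baseChange K)) =
        QuotientAddGroup.map _ T ι hTι (QuotientAddGroup.mk y) := (QuotientAddGroup.map_mk _ T ι hTι y).symm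
    rw [hmap, ← hcf, map_sum]
    refine AddSubgroup.sum_mem _ fun i _ => ?_
    rw [map_zsmul, Function.comp_apply, QuotientAddGroup.map_mk]
    exact AddSubgroup.zsmul_mem _ (AddSubgroup.subset_closure (Set.mem_range_self (Sum.inl i))) _
  have hψL : ∀ y : (W.quadraticTwist c).toAffine.Point,
      (QuotientAddGroup.mk (Φ (ιd y)) : mordellWeilModTorsion (W.baseChange K)) ∈ L := by
    intro y
    have hy : (QuotientAddGroup.mk y : mordellWeilModTorsion (W.quadraticTwist c)) ∈
        Submodule.span ℤ (Set.range (QuotientAddGroup.mk ∘ Pd :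
          _ → mordellWeilModTorsion (W.quadraticTwist c))) := by
      rw [hPd.2]; exact Submodule.mem_top
    obtain ⟨cf, hcf⟩ := Submodule.mem_span_range_iff_exists_fun ℤ |>.mp hy
    have hmap : (QuotientAddGroup.mk (Φ (ιd y)) : mordellWeilModTorsion (W.baseChange K)) =
        QuotientAddGroup.map _ T (Φ.toAddMonoidHom.comp ιd) hTψ (QuotientAddGroup.mk y) :=
      (QuotientAddGroup.map_mk _ T _ hTψ y).symm
    rw [hmap, ← hcf, map_sum]
    refine AddSubgroup.sum_mem _ fun i _ => ?_
    rw [map_zsmul, Function.comp_apply, QuotientAddGroup.map_mk]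
    exact AddSubgroup.zsmul_mem _ (AddSubgroup.subset_closure (Set.mem_range_self (Sum.inr i))) _
  -- `2 · (W(K)/tors) ⊆ L`
  have h2L : ∀ x : mordellWeilModTorsion (W.baseChange K), (2 : ℤ) • x ∈ L := by
    intro x
    induction x using QuotientAddGroup.induction_on with
    | H R =>
      -- `R + σR` is `ℚ`-rational, `R − σR` comes from the twist
      have hfix : σ (R + σ R) = R + σ R := by rw [map_add, hσσ, add_comm]
      obtain ⟨y, hy⟩ := AddMonoidHom.mem_range.mp (mem_range_incl_of_map_conj_eq W K h2 hθ hc _ hfix)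
      have hantifix : σ (R - σ R) = -(R - σ R) := by rw [map_sub, hσσ]; abel
      obtain ⟨y', hy'⟩ := hrange _ hantifix
      have h2R : (2 : ℤ) • R = ι y + Φ (ιd y') := by
        rw [show ι y = R + σ R from hy, hy', two_zsmul]; abel
      rw [← QuotientAddGroup.mk_zsmul, h2R, QuotientAddGroup.mk_add]
      exact L.add_mem (hιL y) (hψL y')
  have hdvd := index_dvd_pow_mordellWeilRank_of_smul_mem L (two_ne_zero) h2L
  rw [hrank, show (2 : ℤ).natAbs = 2 from rfl] at hdvd
  refine ⟨L.index, hdvd, ?_⟩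
  rw [← key, hreg, pow_add]
  ring

end Raw

/-! ## §3 Arbitrary models `Wd ≅ W^{(d_K)}`, `W' ≅ W_K` -/

section Models

variable (W : WeierstrassCurve ℚ) [W.IsElliptic] (K : Type) [Field K] [NumberField K]
  (h2 : Module.finrank ℚ K = 2) (Wd : WeierstrassCurve ℚ) [Wd.IsElliptic]
  (hWd : ∃ C : VariableChange ℚ, C • W.quadraticTwist (NumberField.discr K : ℚ) = Wd)
  (W' : WeierstrassCurve K) [W'.IsElliptic] (hW' : ∃ C : VariableChange K, C • W.baseChange K = W')

include h2 hWd hW' in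
/-- **THE REGULATOR COMPARISON UNDER QUADRATIC BASE CHANGE, ANY RANK.** Let `W/ℚ` be elliptic,
`K` a quadratic field (either signature), `Wd` any `ℚ`-model of the twist `W^{(d_K)}`, `W'` any
`K`-model of `W_K`, and `r = rank W(ℚ) + rank Wd(ℚ)` (`= rank W'(K)`). Then
**`n² · Reg(W'/K) = 2^r · Reg(W/ℚ) · Reg(Wd/ℚ)` for some natural number `n ∣ 2^r`** — so the
regulator ratio `Reg(W')/(Reg(W)·Reg(Wd)) = 2^r/n²` of Milne's quotient is a power of `2`, a
`p`-adic unit at every odd `p`. Raw form `exists_dvd_sq_mul_regulator_baseChange_eq_of_sq`; models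
by `regulator_variableChange_holds`, `mordellWeilRank_variableChange_holds`, `W^{(d_K)} ≅ W^{(c)}`
(`d_K = c q²`, `exists_variableChange_quadraticTwist_mul_sq`). In total rank `≤ 1` this is FILE
E-1's `exists_mul_regulator_baseChange_quadratic_of_rank_add_le_one` (`m = 2n²/2^r`); rank `(1,1)`:
`n ∈ {1,2,4}`, `n² Reg(W') = 4 Reg(W) Reg(Wd)`. [cite: GrossZagier1986, V.§2 (p. 311)]
[cite: SilvermanAEC2009, Exercise 10.16] [cite: Gross2011, Lecture 1 §4, Def. 1.6] -/
theorem exists_dvd_sq_mul_regulator_baseChange_quadratic :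
    ∃ n : ℕ, n ∣ 2 ^ (W.mordellWeilRank + Wd.mordellWeilRank) ∧
      (n : ℝ) ^ 2 * W'.regulator =
        2 ^ (W.mordellWeilRank + Wd.mordellWeilRank) * W.regulator * Wd.regulator := by
  obtain ⟨θ, c, hθ, hc⟩ := Quadratic.exists_sq_eq_algebraMap (F := ℚ) (K := K) h2
  obtain ⟨q, hq, hd⟩ := NumberField.exists_discr_eq_mul_sq h2 hθ hc
  obtain ⟨C₁, hC₁⟩ := W.exists_variableChange_quadraticTwist_mul_sq c q hq
  rw [← hd] at hC₁
  obtain ⟨Cd, hCd⟩ := hWd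
  obtain ⟨C', hC'⟩ := hW'
  subst hCd hC'
  have hc0 : c ≠ 0 := by
    rintro rfl
    apply Quadratic.ne_zero_of_not_mem_range hθ
    have : θ ^ 2 = 0 := by rw [hc, _root_.map_zero]
    exact pow_eq_zero_iff (n := 2) (by norm_num) |>.mp this
  haveI : (W.quadraticTwist c).IsElliptic := W.isElliptic_quadraticTwist hc0
  have hD : (NumberField.discr K : ℚ) ≠ 0 := by exact_mod_cast NumberField.discr_ne_zero K
  haveI : (W.quadraticTwist (NumberField.discr K : ℚ)).IsElliptic := W.isElliptic_quadraticTwist hD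
  haveI : (W.baseChange K).IsElliptic := isElliptic_baseChange' W K
  -- the models have the regulators and ranks of the raw curves
  have hregd : (Cd • W.quadraticTwist (NumberField.discr K : ℚ)).regulator =
      (W.quadraticTwist c).regulator := by
    rw [regulator_variableChange_holds, ← hC₁, regulator_variableChange_holds]
  have hrkd : (Cd • W.quadraticTwist (NumberField.discr K : ℚ)).mordellWeilRank =
      (W.quadraticTwist c).mordellWeilRank := by
    rw [mordellWeilRank_variableChange_holds, ← hC₁, mordellWeilRank_variableChange_holds]
  have hreg' : (C' • W.baseChange K).regulator = (W.baseChange K).regulator :=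
    regulator_variableChange_holds _ C'
  rw [hregd, hrkd, hreg']
  exact exists_dvd_sq_mul_regulator_baseChange_eq_of_sq W K h2 hθ hc

include h2 hWd hW' in
/-- **The shape FILE J-2 consumes: `2^a · Reg(W') = 2^b · (Reg(W) · Reg(Wd))`** (`2^a = n²`,
`2^b = 2^r`), ANY rank, EITHER signature. [cite: GrossZagier1986, V.§2 (p. 311)] -/
theorem exists_two_pow_mul_regulator_baseChange_quadratic :
    ∃ a b : ℕ, (2 : ℝ) ^ a * W'.regulator = 2 ^ b * (W.regulator * Wd.regulator) := by
  obtain ⟨n, hn, h⟩ := exists_dvd_sq_mul_regulator_baseChange_quadratic W K h2 Wd hWd W' hW'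
  obtain ⟨a, -, rfl⟩ := (Nat.dvd_prime_pow Nat.prime_two).mp hn
  refine ⟨2 * a, W.mordellWeilRank + Wd.mordellWeilRank, ?_⟩
  have ha : (((2 ^ a : ℕ) : ℝ)) ^ 2 = (2 : ℝ) ^ (2 * a) := by
    push_cast
    rw [← pow_mul, mul_comm]
  rw [← ha, h, mul_assoc]

include h2 hWd hW' in
/-- **Ranks `(1, 1)` — the case row T-MIL-R2 adds to the descent ENDs: `n² · Reg(W') = 4 · Reg(W) ·
Reg(Wd)` with `n ∈ {1, 2, 4}`** (`n ∣ 2² `). [cite: GrossZagier1986, V.§2 (p. 311)]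
[cite: SilvermanAEC2009, Exercise 10.16] -/
theorem exists_sq_mul_regulator_baseChange_quadratic_of_rank_one_one
    (hrW : W.mordellWeilRank = 1) (hrd : Wd.mordellWeilRank = 1) :
    ∃ n : ℕ, (n = 1 ∨ n = 2 ∨ n = 4) ∧ (n : ℝ) ^ 2 * W'.regulator = 4 * W.regulator * Wd.regulator := by
  obtain ⟨n, hn, h⟩ := exists_dvd_sq_mul_regulator_baseChange_quadratic W K h2 Wd hWd W' hW'
  rw [hrW, hrd] at hn h
  obtain ⟨a, ha, rfl⟩ := (Nat.dvd_prime_pow Nat.prime_two).mp hn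
  refine ⟨2 ^ a, ?_, by rw [h]; norm_num⟩
  interval_cases a <;> simp

end Models

end Summit.BirchSwinnertonDyer.Rank1Residual.AdditivePotMult

end
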